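import Summits.AtomisticToContinuum.FouriersLaw.Theorems.BondHeatUncertaintyBoundedResponseBathHeatE

/-!
# BondHeatUncertainty / BoundedResponse — «BathHeat», part main (F): §5 the graded kernel doors ((BKᶠ_{p,α}), (BK⁺)) — the amplitude-free residual beneath (S)
(lens-1 g107 NODE 107 `…BathHeat.lean` sha256 128247e61f0c3dd6…, 1464 l, cut at section boundaries under the 400-line cap by hand-2 g39 for landing: A = §0 (l.1–266),
B = §1 (l.268–492), C = §2 (l.494–617), D = §3 (l.619–867), E = §4 (l.869–1214), main = §5 (l.1216–1462); bodies byte-verbatim, header l.92–107 repeated; full module docstring in part A.) -/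

noncomputable section

open MeasureTheory ProbabilityTheory Filter Topology Set Function
open scoped NNReal ENNReal
open Literature.MathematicalPhysics.KineticTheory.HeatConduction
open Literature.MathematicalPhysics.KineticTheory OscillatorChain
open Literature.Probability.Process
open Summit.AtomisticToContinuum.FouriersLaw.Theorems.SubdiffusiveBondHeat
open Summit.AtomisticToContinuum.FouriersLaw.Theorems.SubdiffusiveBondHeat.EscapeGrading
open Summit.AtomisticToContinuum.FouriersLaw.Theorems.OddSectorIrreversibility

namespace Summit.AtomisticToContinuum.FouriersLaw.Theorems.BoundedResponse.HeatSpreading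

open Summit.AtomisticToContinuum.FouriersLaw.Theorems.BoundedResponse.TransientContact
open Summit.AtomisticToContinuum.FouriersLaw.Theorems.BoundedResponse.ParityFloor (extensiveBlockEnergyVariance_holds)
open Summit.AtomisticToContinuum.FouriersLaw.Theses.BondHeatUncertainty (BoundedResponse SubdiffusiveBondHeat)

/-! ## §5 Graded kernel doors: (BTᶠ) from a ONE-SIDED, AMPLITUDE-FREE decay floor on the scalar kernel `K_N` -/

/-- **(BKᶠ_{p,α}) `BathKernelFloor p α`** — one-sided decay floor on the kinetic memory kernel of the bath site: `∃ A, r₀ > 0, N₀: ∀ N ≥ N₀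
∀ r ≥ r₀, K_N(r) ≥ −A·N^p·r^{−α}`.  ★ At `(p, α) = (0, 3/2)` it is N-UNIFORM WITH NO AMPLITUDE: «the boundary kinetic-energy
autocorrelation never dips below `−A·r^{−3/2}`» — and it already gives (BTᶠ_1) (`bathTailFloor_one_of_bathKernelFloor`), hence, with (S),
the blocker (`boundedResponse_of_subdiffusiveBondHeat_bathKernelFloor`).  Phonon-TRUE (harmonic chain: `μ_T` Gaussian, `K_N = 2·Cov(p₀(0),p₀(r))²
≥ 0` by Wick — heuristic, not typed), TRUE-leaning for the anharmonic chain (positivity of energy-density correlations past microscopic lags).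
Tag: UNDECIDED · INCOMPARABLE with 11071 (sufficient for (BTᶠ_1) only; a pointwise statement) · INSTRUMENTABLE (one scalar function of `r`).
[route statement · this cell; NOT a literature fact] -/
def BathKernelFloor (p α : ℝ) : Prop :=
  ∀ ω₂ lam β γ : ℝ, 0 < ω₂ → 0 < lam → 0 < β → 0 < γ → ∀ T : ℝ, 0 < T →
    ∃ A r₀ : ℝ, 0 < r₀ ∧ ∃ N₀ : ℕ, ∀ N : ℕ, N₀ ≤ N → ∀ r : ℝ, r₀ ≤ r →
      -(A * (N : ℝ) ^ p * r ^ (-α)) ≤ bathKinCorr ω₂ lam β γ T N r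

/-- **(BK⁺) `BathKernelNonneg`** — the sign statement `K_N(r) ≥ 0` for all `r ≥ r₀` (eventually in `N`): gives `B_N ≥ −γ²T²r₀²`, i.e. (BTᶠ_0)
(`bathTailFloor_zero_of_bathKernelNonneg`).  Phonon-TRUE with `r₀ = 0` (Wick); for the anharmonic chain plausibly false at microscopic lags
(phase anti-correlation of `p₀²` within one period of a strongly anharmonic pinning well), which is why `r₀` is allowed.  Tag: UNDECIDED ·
INCOMPARABLE · INSTRUMENTABLE. [route statement · this cell; NOT a literature fact] -/
def BathKernelNonneg : Prop :=
  ∀ ω₂ lam β γ : ℝ, 0 < ω₂ → 0 < lam → 0 < β → 0 < γ → ∀ T : ℝ, 0 < T →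
    ∃ r₀ : ℝ, 0 ≤ r₀ ∧ ∃ N₀ : ℕ, ∀ N : ℕ, N₀ ≤ N → ∀ r : ℝ, r₀ ≤ r → 0 ≤ bathKinCorr ω₂ lam β γ T N r

section KernelDoors

/-- `min(r,t)·r^{−α}` is integrable on `(0,∞)` for `1 < α < 2`, `t > 0`. [folklore] -/
theorem integrableOn_min_mul_rpow {α t : ℝ} (hα₁ : 1 < α) (hα₂ : α < 2) (ht : 0 < t) :
    IntegrableOn (fun r : ℝ => min r t * r ^ (-α)) (Ioi 0) := by
  rw [← Ioc_union_Ioi_eq_Ioi ht.le]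
  refine IntegrableOn.union ?_ ?_
  · have h : IntegrableOn (fun r : ℝ => r ^ (1 - α)) (Ioc 0 t) :=
      (intervalIntegrable_iff_integrableOn_Ioc_of_le ht.le).1 (intervalIntegral.intervalIntegrable_rpow' (by linarith))
    refine h.congr_fun (fun r hr => ?_) measurableSet_Ioc
    show r ^ (1 - α) = min r t * r ^ (-α)
    rw [min_eq_left hr.2, show (1 : ℝ) - α = 1 + -α by ring, Real.rpow_add hr.1, Real.rpow_one]
  · have h : IntegrableOn (fun r : ℝ => t * r ^ (-α)) (Ioi t) :=
      (integrableOn_Ioi_rpow_of_lt (by linarith) ht).const_mul t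
    refine h.congr_fun (fun r hr => ?_) measurableSet_Ioi
    show t * r ^ (-α) = min r t * r ^ (-α)
    rw [min_eq_right (le_of_lt hr)]

/-- Scaling: `∫_{(0,∞)} min(r,t)·r^{−α} dr = t^{2−α} · ∫_{(0,∞)} min(u,1)·u^{−α} du` (`t > 0`). [folklore] -/
theorem integral_min_mul_rpow_eq {α t : ℝ} (ht : 0 < t) :
    ∫ r in Ioi (0 : ℝ), min r t * r ^ (-α) = t ^ (2 - α) * ∫ u in Ioi (0 : ℝ), min u 1 * u ^ (-α) := by
  have h1 := integral_comp_mul_left_Ioi (fun r : ℝ => min r t * r ^ (-α)) 0 ht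
  simp only [mul_zero, smul_eq_mul] at h1
  have h2 : ∫ x in Ioi (0 : ℝ), min (t * x) t * (t * x) ^ (-α) =
      t ^ (1 - α) * ∫ u in Ioi (0 : ℝ), min u 1 * u ^ (-α) := by
    rw [← integral_const_mul]
    refine setIntegral_congr_fun measurableSet_Ioi (fun x hx => ?_)
    have hx' : (0 : ℝ) < x := hx
    have hmin : min (t * x) t = t * min x 1 := by
      rcases le_total x 1 with h | h
      · rw [min_eq_left h, min_eq_left (mul_le_of_le_one_right ht.le h)]
      · rw [min_eq_right h, min_eq_right (le_mul_of_one_le_right ht.le h), mul_one]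
    show min (t * x) t * (t * x) ^ (-α) = t ^ (1 - α) * (min x 1 * x ^ (-α))
    rw [hmin, Real.mul_rpow ht.le hx'.le, show (1 : ℝ) - α = 1 + -α by ring, Real.rpow_add ht, Real.rpow_one]
    ring
  have h3 : ∫ x in Ioi (0 : ℝ), min x t * x ^ (-α) = t * (t ^ (1 - α) * ∫ u in Ioi (0 : ℝ), min u 1 * u ^ (-α)) := by
    rw [← h2, h1]; field_simp
  rw [h3, show (2 : ℝ) - α = 1 + (1 - α) by ring, Real.rpow_add ht, Real.rpow_one]
  ring

variable {ω₂ lam β γ : ℝ} (hω : 0 < ω₂) (hl : 0 < lam) (hβ : 0 < β) (hγ : 0 < γ) {T : ℝ} (hT : 0 < T)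
include hω hl hβ hγ hT

/-- `min(r,t)·K_N(r)` is integrable on `(0,∞)` (`|·| ≤ t|K_N|`). [folklore] -/
theorem integrableOn_min_mul_bathKinCorr {N : ℕ} (hN : 0 < N) {t : ℝ} (ht : 0 ≤ t) :
    IntegrableOn (fun r : ℝ => min r t * bathKinCorr ω₂ lam β γ T N r) (Ioi 0) := by
  obtain ⟨hKc, -, hL1⟩ := bathKinCorr_basics hω hl hβ hγ hT hN
  refine Integrable.mono' (hL1.abs.const_mul t) ((continuous_id.min continuous_const).mul hKc).aestronglyMeasurable ?_
  filter_upwards [ae_restrict_mem measurableSet_Ioi] with r hr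
  rw [Real.norm_eq_abs, abs_mul, abs_of_nonneg (le_min (le_of_lt hr) ht)]
  exact mul_le_mul_of_nonneg_right (min_le_right _ _) (abs_nonneg _)

/-- A pointwise floor `K_N ≥ −L` on `(0,∞)` integrates: `B_N(t) ≥ −γ² ∫_{(0,∞)} min(r,t)·L(r) dr` (`L·min` integrable). [folklore] -/
theorem bathTail_ge_of_floor {N : ℕ} (hN : 0 < N) {t : ℝ} (ht : 0 ≤ t) {L : ℝ → ℝ}
    (hLi : IntegrableOn (fun r : ℝ => min r t * L r) (Ioi 0))
    (hKL : ∀ r : ℝ, 0 < r → -L r ≤ bathKinCorr ω₂ lam β γ T N r) :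
    -(γ ^ 2 * ∫ r in Ioi (0 : ℝ), min r t * L r) ≤ bathTail ω₂ lam β γ T N t := by
  unfold bathTail
  have hmono : ∫ r in Ioi (0 : ℝ), -(min r t * L r) ≤ ∫ r in Ioi (0 : ℝ), min r t * bathKinCorr ω₂ lam β γ T N r := by
    refine setIntegral_mono_on hLi.neg (integrableOn_min_mul_bathKinCorr hω hl hβ hγ hT hN ht) measurableSet_Ioi
      (fun r hr => ?_)
    have hm : 0 ≤ min r t := le_min (le_of_lt hr) ht
    have := mul_le_mul_of_nonneg_left (hKL r hr) hm
    linarith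
  rw [integral_neg] at hmono
  have hγ2 : 0 ≤ γ ^ 2 := sq_nonneg γ
  nlinarith

omit hω hl hβ hγ hT

/-- ★ **(BK⁺) ⟹ (BTᶠ_0)**: `K_N ≥ 0` past `r₀` gives `B_N(t) ≥ −γ²T²r₀²` for every `t ≥ 0`. [folklore] -/
theorem bathTailFloor_zero_of_bathKernelNonneg (hK : BathKernelNonneg) : BathTailFloor 0 := by
  intro ω₂ lam β γ hω hl hβ hγ T hT c hc
  obtain ⟨r₀, hr₀, N₀, hK⟩ := hK ω₂ lam β γ hω hl hβ hγ T hT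
  refine ⟨γ ^ 2 * (2 * T ^ 2 * r₀ * r₀), max N₀ 1, fun N hN => ?_⟩
  have hNN₀ : N₀ ≤ N := le_trans (le_max_left _ _) hN
  have hN1 : 1 ≤ N := le_trans (le_max_right _ _) hN
  set t := c * (N : ℝ) ^ 2 with htdef
  have ht : 0 ≤ t := by positivity
  obtain ⟨-, habs, -⟩ := bathKinCorr_basics hω hl hβ hγ hT (N := N) (by omega)
  -- floor `L := (Iic r₀).indicator (2T²)`; `∫ min(r,t)·L ≤ r₀ · 2T² r₀`
  have hLi : IntegrableOn (fun r : ℝ => min r t * (Ioc 0 r₀).indicator (fun _ => 2 * T ^ 2) r) (Ioi 0) := by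
    have h1 : IntegrableOn (fun r : ℝ => min r t * (2 * T ^ 2)) (Ioc 0 r₀) :=
      ((continuous_id.min continuous_const).mul continuous_const).integrableOn_Icc.mono_set Ioc_subset_Icc_self
    have h2 : IntegrableOn (fun r : ℝ => (Ioc 0 r₀).indicator (fun r => min r t * (2 * T ^ 2)) r) (Ioi 0) :=
      (h1.integrable_indicator measurableSet_Ioc).integrableOn
    refine h2.congr_fun (fun r _ => ?_) measurableSet_Ioi
    by_cases h : r ∈ Ioc 0 r₀
    · simp only [indicator_of_mem h]
    · simp only [indicator_of_notMem h, mul_zero]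
  have hfl := bathTail_ge_of_floor hω hl hβ hγ hT (N := N) (by omega) ht hLi (fun r hr => ?_)
  · have hI : ∫ r in Ioi (0 : ℝ), min r t * (Ioc 0 r₀).indicator (fun _ => 2 * T ^ 2) r ≤ 2 * T ^ 2 * r₀ * r₀ := by
      have hb : ∫ r in Ioi (0 : ℝ), min r t * (Ioc 0 r₀).indicator (fun _ => 2 * T ^ 2) r ≤
          ∫ r in Ioi (0 : ℝ), (Ioc 0 r₀).indicator (fun _ => 2 * T ^ 2 * r₀) r := by
        have hci : IntegrableOn (fun _ : ℝ => 2 * T ^ 2 * r₀) (Ioc 0 r₀) :=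
          (continuous_const : Continuous fun _ : ℝ => 2 * T ^ 2 * r₀).integrableOn_Icc.mono_set Ioc_subset_Icc_self
        refine setIntegral_mono_on hLi (hci.integrable_indicator measurableSet_Ioc).integrableOn
          measurableSet_Ioi (fun r hr => ?_)
        by_cases h : r ∈ Ioc 0 r₀
        · simp only [indicator_of_mem h]
          have : min r t ≤ r₀ := (min_le_left _ _).trans h.2
          have hT2 : 0 ≤ 2 * T ^ 2 := by positivity
          nlinarith
        · simp only [indicator_of_notMem h, mul_zero, le_refl]
      refine hb.trans (le_of_eq ?_)
      rw [integral_indicator measurableSet_Ioc, Measure.restrict_restrict measurableSet_Ioc,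
        Ioc_inter_Ioi, sup_idem, setIntegral_const, Real.volume_real_Ioc_of_le hr₀, smul_eq_mul]
      ring
    rw [Real.rpow_zero, mul_one]
    have := mul_le_mul_of_nonneg_left hI (sq_nonneg γ)
    linarith
  · by_cases h : r ∈ Ioc 0 r₀
    · simp only [indicator_of_mem h]
      exact (abs_le.1 (habs r)).1
    · simp only [indicator_of_notMem h, neg_zero]
      exact hK N hNN₀ r (by simp only [mem_Ioc, not_and, not_le] at h; exact (h hr).le)

/-- ★★ **(BKᶠ_{p,α}) ⟹ (BTᶠ_{max(p,0)+4−2α})** for `1 < α < 2`: extend the floor to all of `(0,∞)` as `K_N ≥ −(A⁺N^p + 2T²r₀^α)·r^{−α}`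
(`|K_N| ≤ 2T²` before `r₀`), integrate against `min(r,cN²)` and scale (`∫ min(r,t)r^{−α} = t^{2−α}·c_α`).  Grade bookkeeping
`p + 4 − 2α` = that of NODE 106's `(PTDᶜ_{p,α})` — but here `p = 0` ALREADY GIVES GRADE 1 at the diffusive rate `α = 3/2`. [this cell] -/
theorem bathTailFloor_of_bathKernelFloor {p α : ℝ} (hα₁ : 1 < α) (hα₂ : α < 2) (hK : BathKernelFloor p α) :
    BathTailFloor (max p 0 + 4 - 2 * α) := by
  intro ω₂ lam β γ hω hl hβ hγ T hT c hc
  obtain ⟨A, r₀, hr₀, N₀, hA⟩ := hK ω₂ lam β γ hω hl hβ hγ T hT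
  set Cα : ℝ := ∫ u in Ioi (0 : ℝ), min u 1 * u ^ (-α) with hCα
  have hCα0 : 0 ≤ Cα :=
    setIntegral_nonneg measurableSet_Ioi fun u hu =>
      mul_nonneg (le_min (le_of_lt hu) zero_le_one) (Real.rpow_nonneg (le_of_lt hu) _)
  refine ⟨γ ^ 2 * ((max A 0 + 2 * T ^ 2 * r₀ ^ α) * (c ^ (2 - α) * Cα)), max N₀ 1, fun N hN => ?_⟩
  have hNN₀ : N₀ ≤ N := le_trans (le_max_left _ _) hN
  have hN1' : 1 ≤ N := le_trans (le_max_right _ _) hN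
  have hN1 : (1 : ℝ) ≤ N := by exact_mod_cast hN1'
  have hNpos : (0 : ℝ) < N := by linarith
  set t := c * (N : ℝ) ^ 2 with htdef
  have ht : 0 < t := by positivity
  obtain ⟨-, habs, -⟩ := bathKinCorr_basics hω hl hβ hγ hT (N := N) (by omega)
  -- the global floor
  set A'' : ℝ := max A 0 * (N : ℝ) ^ p + 2 * T ^ 2 * r₀ ^ α with hA''
  have hNp : 0 ≤ (N : ℝ) ^ p := Real.rpow_nonneg hNpos.le p
  have hfloor : ∀ r : ℝ, 0 < r → -(A'' * (r ^ (-α))) ≤ bathKinCorr ω₂ lam β γ T N r := by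
    intro r hr
    have hrα : 0 ≤ r ^ (-α) := Real.rpow_nonneg hr.le _
    have h1 : 0 ≤ max A 0 * (N : ℝ) ^ p * r ^ (-α) := by positivity
    have h2 : 0 ≤ 2 * T ^ 2 * r₀ ^ α * r ^ (-α) := by positivity
    rcases le_or_gt r₀ r with hr₀r | hrr₀
    · have h3 := hA N hNN₀ r hr₀r
      have h4 : A * (N : ℝ) ^ p * r ^ (-α) ≤ max A 0 * (N : ℝ) ^ p * r ^ (-α) :=
        mul_le_mul_of_nonneg_right (mul_le_mul_of_nonneg_right (le_max_left _ _) hNp) hrα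
      rw [hA'']
      nlinarith
    · have h4 : 1 ≤ r₀ ^ α * r ^ (-α) := by
        rw [Real.rpow_neg hr.le, ← div_eq_mul_inv, ← Real.div_rpow hr₀.le hr.le]
        exact Real.one_le_rpow (by rw [le_div_iff₀ hr]; linarith) (by linarith)
      have h5 := (abs_le.1 (habs r)).1
      have hT2 : 0 ≤ 2 * T ^ 2 := by positivity
      rw [hA'']
      nlinarith [mul_le_mul_of_nonneg_left h4 hT2]
  have hLi : IntegrableOn (fun r : ℝ => min r t * (A'' * r ^ (-α))) (Ioi 0) := by
    have h0 : IntegrableOn (fun r : ℝ => A'' * (min r t * r ^ (-α))) (Ioi 0) :=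
      (integrableOn_min_mul_rpow hα₁ hα₂ ht).const_mul A''
    refine h0.congr_fun (fun r _ => ?_) measurableSet_Ioi
    show A'' * (min r t * r ^ (-α)) = min r t * (A'' * r ^ (-α))
    ring
  have hfl := bathTail_ge_of_floor hω hl hβ hγ hT (N := N) (by omega) ht.le hLi hfloor
  -- evaluate the majorant integral
  have hval : ∫ r in Ioi (0 : ℝ), min r t * (A'' * r ^ (-α)) = A'' * (t ^ (2 - α) * Cα) := by
    rw [← integral_min_mul_rpow_eq ht, ← integral_const_mul]
    refine integral_congr_ae (Eventually.of_forall fun r => ?_)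
    show min r t * (A'' * r ^ (-α)) = A'' * (min r t * r ^ (-α))
    ring
  rw [hval] at hfl
  -- compare `A'' t^{2−α}` with the advertised constant times `N^{max p 0 + 4 − 2α}`
  have hA''0 : 0 ≤ A'' := by positivity
  have ht2 : t ^ (2 - α) = c ^ (2 - α) * (N : ℝ) ^ (4 - 2 * α) := by
    rw [htdef, Real.mul_rpow hc.le (sq_nonneg _), show ((N : ℝ) ^ 2) = (N : ℝ) ^ ((2 : ℕ) : ℝ) from
      (Real.rpow_natCast _ 2).symm, ← Real.rpow_mul hNpos.le]
    norm_num
    left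
    ring_nf
  have hmax : A'' ≤ (max A 0 + 2 * T ^ 2 * r₀ ^ α) * (N : ℝ) ^ (max p 0) := by
    have h1 : (N : ℝ) ^ p ≤ (N : ℝ) ^ (max p 0) := Real.rpow_le_rpow_of_exponent_le hN1 (le_max_left _ _)
    have h2 : 1 ≤ (N : ℝ) ^ (max p 0) := Real.one_le_rpow hN1 (le_max_right _ _)
    have h3 : 0 ≤ 2 * T ^ 2 * r₀ ^ α := by positivity
    rw [hA'']
    nlinarith [mul_le_mul_of_nonneg_left h1 (le_max_right A 0), mul_le_mul_of_nonneg_left h2 h3]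
  have hsplit : (N : ℝ) ^ (max p 0 + 4 - 2 * α) = (N : ℝ) ^ (max p 0) * (N : ℝ) ^ (4 - 2 * α) := by
    rw [show max p 0 + 4 - 2 * α = max p 0 + (4 - 2 * α) by ring, Real.rpow_add hNpos]
  rw [hsplit]
  have hcC : 0 ≤ c ^ (2 - α) * Cα := mul_nonneg (Real.rpow_nonneg hc.le _) hCα0
  have hN4 : 0 ≤ (N : ℝ) ^ (4 - 2 * α) := Real.rpow_nonneg hNpos.le _
  have key : A'' * (t ^ (2 - α) * Cα) ≤ (max A 0 + 2 * T ^ 2 * r₀ ^ α) * (c ^ (2 - α) * Cα) *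
      ((N : ℝ) ^ (max p 0) * (N : ℝ) ^ (4 - 2 * α)) := by
    rw [ht2]
    have := mul_le_mul_of_nonneg_right hmax (mul_nonneg hcC hN4)
    nlinarith
  have hγ2 : 0 ≤ γ ^ 2 := sq_nonneg γ
  nlinarith [mul_le_mul_of_nonneg_left key hγ2]

/-- ★ **(BKᶠ_{0,3/2}) ⟹ (BTᶠ_1)**: the amplitude-free diffusive floor `K_N ≥ −A·r^{−3/2}` gives the grade-1 bath tail floor. [this cell] -/
theorem bathTailFloor_one_of_bathKernelFloor (hK : BathKernelFloor 0 (3 / 2)) : BathTailFloor 1 := by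
  have h := bathTailFloor_of_bathKernelFloor (by norm_num) (by norm_num) hK
  rwa [show max (0 : ℝ) 0 + 4 - 2 * (3 / 2) = 1 by norm_num] at h

/-- ★★ **(S) ∧ (BKᶠ_{0,3/2}) ⟹ 11071** — the (S)-door in kernel currency: beneath (S) the blocker follows from an N-UNIFORM, AMPLITUDE-FREE,
ONE-SIDED decay floor on ONE scalar function, the boundary kinetic-energy autocorrelation. [this cell] -/
theorem boundedResponse_of_subdiffusiveBondHeat_bathKernelFloor (hS : SubdiffusiveBondHeat) (hK : BathKernelFloor 0 (3 / 2)) :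
    BoundedResponse :=
  boundedResponse_of_bathHeatPoint_bathTailFloor (bathHeatPoint_one_of_subdiffusiveBondHeat hS)
    (bathTailFloor_one_of_bathKernelFloor hK)

/-- **(BHᴾ_1) ∧ (BK⁺) ⟹ 11071** (floor grade `0 ≤ 1`). [this cell] -/
theorem boundedResponse_of_bathHeatPoint_bathKernelNonneg (hP : BathHeatPoint 1) (hK : BathKernelNonneg) : BoundedResponse := by
  refine boundedResponse_of_bathHeatPoint_bathTailFloor hP fun ω₂ lam β γ hω hl hβ hγ T hT c hc => ?_
  obtain ⟨C, N₀, hC⟩ := bathTailFloor_zero_of_bathKernelNonneg hK ω₂ lam β γ hω hl hβ hγ T hT c hc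
  refine ⟨max C 0, max N₀ 1, fun N hN => ?_⟩
  have hNN₀ : N₀ ≤ N := le_trans (le_max_left _ _) hN
  have hN1 : (1 : ℝ) ≤ N := by exact_mod_cast le_trans (le_max_right _ _) hN
  have h := hC N hNN₀
  rw [Real.rpow_zero, mul_one] at h
  rw [Real.rpow_one]
  nlinarith [le_max_left C 0, le_max_right C 0]

end KernelDoors

end Summit.AtomisticToContinuum.FouriersLaw.Theorems.BoundedResponse.HeatSpreading

end
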